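/-
Origin: expansion seat `planner-pub-hodgecm-mc-period-2-g5-0`, handover #1 2026-08-19T02:50Z md5 00734f9e594dc7e4f82b355b560e96eb (NEW additive leaf, 345 l., W6b-3 μ-PRODUCER = BINDER-TRIAGE §36.6 «μ — producer named with the literal check N1», BOOKED model2-g4 (VV′)(1) 02:23:34Z + model1-g4 CONTENT CONSENT 02:26:07Z, INTERFACE LINE 02:36:56Z (no objection in the window; sanity-1-g5 02:40:28Z READ); imports INSTALLED r33 modules HodgeCM.Model.ThetaSpaceInputPin + Hodg (`HOME/mc/pub-hodgecm-mc-period-2/g5/pkg/HodgeCM/Model/ArchTypeReadOff.lean`, md5 00734f9e, 345 lines);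
landed by the gen-10 packager (p-g10) in gate run 34 as `HodgeCM/Model/ArchTypeReadOff.lean` (verbatim).
-/
/-
Copyright (c) 2026. Released under Apache 2.0 license as described in the file LICENSE.
Cell pub-hodgecm, MODEL layer (construction prover mc-period-2, gen 5 — CM period / torus lane), node W6b-3 (μ):
BINDER-TRIAGE §36.6 «`μ` — producer to be named with the literal check N1» (prl1-g14 2026-08-19T00:34:54Z (2)).
Target in PKG: `HodgeCM/Model/ArchTypeReadOff.lean` (NEW additive leaf; imports `HodgeCM.Model.ThetaSpaceInputPin`
(theta-3-g3 #6) and `HodgeCM.Model.ThetaSideInstance` (period-2-g4 #1) only; nothing landed imports it).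
KERNEL ONLY: every declaration below is proved from the package as it stands; 0 records, 0 cited hypotheses,
0 `def … : Prop`, MODEL-N ± 0.  `#print axioms` of every theorem ⊆ [propext, Classical.choice, Quot.sound].
-/
import Summits.HodgeConjecture.HodgeCM.Model.ThetaSpaceInputPin_2
import Summits.HodgeConjecture.HodgeCM.Model.ThetaSideInstance

/-!
# N1 — the archimedean exponents `μ` READ OFF the adelic side `S`

Node E (`HodgeCM.Model.perL_picardCM_r10 … r12`) carries two DATA binders that speak about the same four
lines `W_k`, `k : Fin 4`, of the seesaw:

* `S : ∀ {L ι₁} (V : HermSpace3 L ι₁) (c : SeesawCtx L), ThetaAdelicSide V c` — per line the Weil pair data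
  `(S V c).P k : WeilPairData L⁺ L (Fin 3) G_U(𝔸)` with its archimedean test vector `φ_∞ = ((S V c).P k).Φinf`,
  the test functions `φ_N = testFun L⁺ (Fin 3) φ_∞ x₀ N` and the (W-wt) weight
  `((S V c).P k).w : U(W_k)(L⁺ ⊗ ℝ) → ℂ`, `ω(1, t_∞) φ_N = w(t_∞) • φ_N` (`WeilPairData.weight`);
* `μ : ∀ {L : CMField}, SeesawCtx L → Fin 4 → InfinitePlace L → ℤ` — the archimedean exponents, entering E ONLY
  through the torus sides `d12Of μ c = (-μ c 0, -μ c 1)`, `d34Of μ c = (-μ c 2, -μ c 3)` (`ThetaSideInstance`),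
  i.e. through the character index sets `SeesawTorus.allowedChars L (-μ c 0) (-μ c 1)` / `… (-μ c 2) (-μ c 3)` of
  the (12)/(34) torus data read by `gen12 / hyp12 / real34 / hyp34`.

PerL (v5, `PerL-v5-FULL-d912a121.tex`) identifies them: l. 398 "Let $w:=(e_b(\Psi_1),e_b(\Psi_2))_b$ be the
archimedean type of the characters $\chi_{12}$ of allowed pairs of type $(12)$", ll. 399 / 405 / 424 "every character
$\chi$ of $[T]$ with $\chi_\infty=w$", l. 476 "$\U(W_{i,b})=\U(1)$ acts on it by a character $u\mapsto
u^{-e_b(\Psi_i)}$, which \emph{defines} $e_b(\Psi_i)\in\Z$", l. 481 "$\chi'_{i,b}(u)=u^{e_b(\Psi_i)}$".  SIGN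
DICTIONARY: `archWeight L (μ c k)` is the character of `U(W_k)(L⁺ ⊗ ℝ)` on `φ⁰_k`, so `μ c k ↔ (-e_b(Ψ_k))_b`; the
side types `(d12Of μ c).m_j = -μ c j ↔ (e_b)_b` are the types of the characters `χ'` (l. 481), and the residual's
type condition `χ(cl t_∞) · w(t_∞) = 1` says exactly `type(χ) = -type(w)` (§ 3 below).  In the package this
identity — the reviewers' LITERAL CHECK **N1** (prl1-g13 2026-08-18T22:13:54Z review of W6b-3 (T), prl1-g14 2026-08-19T00:34:54Z (2); recipe of record
period-2-g2 21:34:23Z: `archWeight L (μ c k)` = the character by which `U(W_k)(L⁺ ⊗ ℝ)` acts on `φ⁰_k`,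
`SideData.m_k = -μ_k`, factor order `(μ c 0, μ c 1) ↔ (charFst, charSnd)`) — was so far asserted NOWHERE: only the
joint inhabitability of `gen12` enforces it (theta-3-g3 02:15:57Z, finding H2).  This leaf makes it a kernel
statement about the constructed objects:

1. `archTypeOf L c` — the archimedean type of a weight function `c : U(1)(L⁺ ⊗ ℝ) → ℂ` READ OFF `c`: the unique
   `m : InfinitePlace L → ℤ` with `c = archWeight L m` (`NumberField.archWeight_injective`, pv11-g5) when `c` is
   typed, `0` otherwise (total, classical); `archWeight_archTypeOf`, `archTypeOf_eq_iff`, `archTypeOf_archWeight`.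
2. Lines: on a line `ℂ φ`, `φ ≠ 0`, the scalar weight is determined by the orbit (`eq_archWeight_of_line`), and the
   test functions are non-zero, `testFun_ne_zero` (`φ_N(x₀) = φ_∞(ι x₀) ≠ 0`, `WeilLineData.hx₀`).
3. Pair data (`WeilPairData`, K = L⁺): `P.archType := archTypeOf L P.w` — **the archimedean type of the line READ
   OFF the pair data**; `omega_arch_testFun` ((W-wt) with the typed weight), `w_eq_archWeight_of_omega` /
   `archType_eq_of_omega` (the type is what ONE orbit identity `ω(1,t_∞) φ_N = archWeight L m t_∞ • φ_N`, `N ≥ 1`,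
   says it is), and the junction with the residual (W-resT) of `SupplyResidual`: its type condition
   `χ(cl t_∞) · w(t_∞) = 1` IS `SeesawTorus.HasArchType L χ (-m)` (`residualType_iff_hasArchType_neg`) — the
   characters the supply of line `k` produces are exactly those of the side type `-μ c k = (d12Of μ c).m₁, …`.
4. N1 for E's binders (`§ 4`): under the binder-shaped hypothesis
   `hN1 : ∀ V c k, ((S V c).P k).w = ⇑(archWeight L (μ c k))` — the text we propose for E's property binder `hμ`
   when the `gen12`/`hyp12` discharges need it — `μ c k = ((S V c).P k).archType` (`mu_eq_archType`, so `μ` is then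
   DETERMINED by `S`, and `V`-independent because its type says so), `d12Of μ c = (-(type of line 0), -(type of
   line 1))` (`d12Of_eq_of_N1`, `d34Of_eq_of_N1`), and the (W-resT) characters of line `k` are the characters of
   `HasArchType … (-μ c k)` (`residualType_iff_of_N1`), so that the pairs of residual characters of lines `0, 1` (resp. `2, 3`)
   are exactly the index set `SeesawTorus.allowedChars` of the (12)- (resp. (34)-) torus datum of `d12Of μ` / `d34Of μ`
   — factor order `0 ↔ charFst`, `1 ↔ charSnd` (N1, prl1-g13) — `charPair_mem_allowedChars_d12_iff_of_N1` / `…_d34_…`.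

Nothing here pins the VALUE of `μ` (the closed form `E(±)` of PerL l. 476 ff. is binder-1's `eOfSign` lane); this
file supplies the two maps `S ↦ type` and `N1 : μ = type ∘ S` between the binders, kernel-checked.

Vocabulary: PKG `NumberField.unitaryLineArchTorus L = relNormOneInfUnits L⁺ L` (`NormOneRelTorusArch`),
`NumberField.archWeight` (`SeesawTorus`), `NumberField.SeesawTorus.HasArchType` / `hasArchType_iff`,
`NumberField.archWeight_injective` / `archWeight_neg` (`SeesawChars`); the pair data are typed over the vendored
twins `HodgeCM.Vendored.H21.NumberTheory.Automorphic.RelNormOneTorus{,Arch}` (`Literature.NumberTheory.Automorphic.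
relNormOneInfUnits / relNormOneInfToIdeles / relNormOneIdeles / relNormOneRat`), which are the PKG objects by `rfl`
(period-2-g2 J-T dictionary T1–T4; re-checked in this file's scratch probe), so no transport appears below.
-/

set_option autoImplicit false

noncomputable section

open NumberField (InfinitePlace IsCMField maximalRealSubfield unitaryLineArchTorus archWeight archWeight_injective archWeight_neg
  archWeight_zero norm_archWeight relNormOneInfToQuot)
open NumberField.SeesawTorus (HasArchType hasArchType_iff)
open NumberField.mixedEmbedding
open scoped NumberField Classical
open Literature.NumberTheory.Automorphic Literature.NumberTheory.Weil1964
open HodgeCM.PerL34.RationalCoset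
open HodgeCM.Model.SupplyInstance HodgeCM.Model.SupplyResidual
open HodgeCM.Universe (SideData SideArchType)

namespace HodgeCM
namespace Model

/-! ## 1. The archimedean type of a weight function, read off -/

section ArchTypeOf

variable (L : Type) [Field L] [NumberField L] [IsCMField L]

open scoped Classical in
/-- **The archimedean type READ OFF a weight function** `c : U(1)(L⁺ ⊗ ℝ) → ℂ`: the unique `m` with
`c = archWeight L m` if `c` is a typed character (`archWeight_injective`), and `0` otherwise. -/
def archTypeOf (c : unitaryLineArchTorus L → ℂ) : InfinitePlace L → ℤ :=
  if h : ∃ m : InfinitePlace L → ℤ, ⇑(archWeight L m) = c then h.choose else 0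

variable {L}

/-- (Ported verbatim from the HodgeCMPerL package; no docstring in the source.) -/
theorem archWeight_archTypeOf {c : unitaryLineArchTorus L → ℂ} (h : ∃ m : InfinitePlace L → ℤ, ⇑(archWeight L m) = c) :
    ⇑(archWeight L (archTypeOf L c)) = c := by
  rw [archTypeOf, dif_pos h]
  exact h.choose_spec

/-- For a typed weight function, `archTypeOf L c = m ↔ c = archWeight L m`. -/
theorem archTypeOf_eq_iff {c : unitaryLineArchTorus L → ℂ} (h : ∃ m : InfinitePlace L → ℤ, ⇑(archWeight L m) = c)
    (m : InfinitePlace L → ℤ) : archTypeOf L c = m ↔ ⇑(archWeight L m) = c := by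
  constructor
  · rintro rfl
    exact archWeight_archTypeOf h
  · intro hm
    exact archWeight_injective (DFunLike.coe_injective ((archWeight_archTypeOf h).trans hm.symm))

/-- The type of `c = archWeight L m` is `m`. -/
theorem archTypeOf_eq {c : unitaryLineArchTorus L → ℂ} {m : InfinitePlace L → ℤ} (hm : ⇑(archWeight L m) = c) :
    archTypeOf L c = m :=
  (archTypeOf_eq_iff ⟨m, hm⟩ m).2 hm

/-- (Ported verbatim from the HodgeCMPerL package; no docstring in the source.) -/
@[simp] theorem archTypeOf_archWeight (m : InfinitePlace L → ℤ) : archTypeOf L (archWeight L m) = m :=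
  archTypeOf_eq rfl

/-! ## 2. Lines: the weight of a stable line is determined by its orbit -/

/-- On a line `ℂ φ`, `φ ≠ 0`: if the orbit `o` is `t ↦ c t • φ` and also `t ↦ archWeight L m t • φ`, then the scalar
weight `c` IS the typed character `archWeight L m`. -/
theorem eq_archWeight_of_line {W : Type*} [AddCommGroup W] [Module ℂ W] {φ : W} (hφ : φ ≠ 0)
    {o : unitaryLineArchTorus L → W} {c : unitaryLineArchTorus L → ℂ} (hc : ∀ t, o t = c t • φ)
    {m : InfinitePlace L → ℤ} (hm : ∀ t, o t = archWeight L m t • φ) : c = ⇑(archWeight L m) :=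
  funext fun t => smul_left_injective ℂ hφ ((hc t).symm.trans (hm t))

/-- … hence its read-off type is `m`. -/
theorem archTypeOf_eq_of_line {W : Type*} [AddCommGroup W] [Module ℂ W] {φ : W} (hφ : φ ≠ 0)
    {o : unitaryLineArchTorus L → W} {c : unitaryLineArchTorus L → ℂ} (hc : ∀ t, o t = c t • φ)
    {m : InfinitePlace L → ℤ} (hm : ∀ t, o t = archWeight L m t • φ) : archTypeOf L c = m :=
  archTypeOf_eq (eq_archWeight_of_line hφ hc hm).symm

end ArchTypeOf

/-! ## 3. The test functions are non-zero; the type of a line of pair data -/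

section TestFun

variable {K : Type} [Field K] [NumberField K] {J : Type} [Fintype J]

attribute [local instance] ratModule

omit [Fintype J] in
/-- `x₀ ∈ x₀ + N L̂`. -/
theorem self_mem_thinCosetK' (x₀ : J → K) (N : ℕ) :
    x₀ ∈ thinCosetK (finEmb K J) (intLattice K J) x₀ N :=
  (mem_thinCosetK _ _ x₀ x₀ N).2 ⟨0, Submodule.zero_mem _, by rw [smul_zero, add_zero]⟩

/-- **The test functions are non-zero**: `φ_N(x₀) = φ_∞(ι x₀) ≠ 0` for `N ≥ 1` (`testFun_ratPt`, the base point lies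
in its own thin coset, and the record's `hx₀`). -/
theorem testFun_ne_zero (Φinf : SchwartzMap (J → mixedSpace K) ℂ) {x₀ : J → K} (hx₀ : Φinf (archEmb K J x₀) ≠ 0)
    {N : ℕ} (hN : N ≠ 0) : testFun K J Φinf x₀ N ≠ 0 := by
  intro h
  have h2 := congrArg (fun F : piSchwartzBruhat K J => (F : (J → NumberField.AdeleRing (𝓞 K) K) → ℂ) (ratPt K J x₀)) h
  simp only [testFun_ratPt _ _ _ _ hN, Set.indicator_of_mem (self_mem_thinCosetK' _ _)] at h2
  exact hx₀ h2

end TestFun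

namespace SupplyResidual
namespace WeilPairData

variable {L : Type} [Field L] [NumberField L] [IsCMField L] {J : Type} [Fintype J] {GU : Type} [Group GU]
  [TopologicalSpace GU]


variable (P : WeilPairData (maximalRealSubfield L) L J GU)

/-- **The archimedean type of the line READ OFF the pair data**: the type of its (W-wt) weight `P.w`. -/
def archType : InfinitePlace L → ℤ := archTypeOf L P.w

/-- (Ported verbatim from the HodgeCMPerL package; no docstring in the source.) -/
theorem archType_def : P.archType = archTypeOf L P.w := rfl

/-- (W-wt) with the typed weight: if `P.w` is typed, `ω(1, t_∞) φ_N = archWeight L P.archType t_∞ • φ_N`. -/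
theorem omega_arch_testFun (h : ∃ m : InfinitePlace L → ℤ, ⇑(archWeight L m) = P.w) (N : ℕ)
    (t : unitaryLineArchTorus L) :
    P.ω (1, relNormOneInfToIdeles (maximalRealSubfield L) L t) (testFun (maximalRealSubfield L) J P.Φinf P.x₀ N) =
      archWeight L P.archType t • testFun (maximalRealSubfield L) J P.Φinf P.x₀ N := by
  rw [P.weight N t, archType, archWeight_archTypeOf h]

/-- ONE typed orbit identity at a level `N ≥ 1` determines the weight: if `ω(1, t_∞) φ_N = archWeight L m t_∞ • φ_N`
for all `t_∞`, then `P.w = archWeight L m` … -/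
theorem w_eq_archWeight_of_omega {N : ℕ} (hN : N ≠ 0) {m : InfinitePlace L → ℤ}
    (hm : ∀ t : unitaryLineArchTorus L,
      P.ω (1, relNormOneInfToIdeles (maximalRealSubfield L) L t) (testFun (maximalRealSubfield L) J P.Φinf P.x₀ N) =
        archWeight L m t • testFun (maximalRealSubfield L) J P.Φinf P.x₀ N) :
    P.w = ⇑(archWeight L m) :=
  eq_archWeight_of_line (testFun_ne_zero P.Φinf P.hx₀ hN) (P.weight N) hm

/-- … and the read-off type is `m`. -/
theorem archType_eq_of_omega {N : ℕ} (hN : N ≠ 0) {m : InfinitePlace L → ℤ}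
    (hm : ∀ t : unitaryLineArchTorus L,
      P.ω (1, relNormOneInfToIdeles (maximalRealSubfield L) L t) (testFun (maximalRealSubfield L) J P.Φinf P.x₀ N) =
        archWeight L m t • testFun (maximalRealSubfield L) J P.Φinf P.x₀ N) :
    P.archType = m :=
  archTypeOf_eq (P.w_eq_archWeight_of_omega hN hm).symm

/-- If `P.w = archWeight L m` then the read-off type is `m`. -/
theorem archType_eq_of_w_eq {m : InfinitePlace L → ℤ} (hw : P.w = ⇑(archWeight L m)) : P.archType = m :=
  archTypeOf_eq hw.symm

/-- **Degenerate side** (sanity-1's `trivialPairDataAt` / `degS`: `w := 1`): the read-off type of a trivial weight is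
`0` — an `rfl`-fed check (`archType_eq_zero_of_w _ fun _ => rfl` there). -/
theorem archType_eq_zero_of_w (hw : ∀ t, P.w t = 1) : P.archType = 0 :=
  archTypeOf_eq (funext fun t => by rw [hw t, archWeight_zero])

/-- **Junction with the residual (W-resT).**  For a typed weight `P.w = archWeight L m`, the type condition of
`WeilPairData.ResidualT` on a character `χ` of `[U(W_j)]` — `χ(cl t_∞) · w(t_∞) = 1` for all `t_∞` — IS
"`χ` has archimedean type `-m`" (`SeesawTorus.HasArchType`, pv11: `χ ∘ cl = archWeight L (-m)`). -/
theorem residualType_iff_hasArchType_neg {m : InfinitePlace L → ℤ} (hw : P.w = ⇑(archWeight L m))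
    (χ : PontryaginDual (relNormOneIdeles (maximalRealSubfield L) L ⧸ relNormOneRat (maximalRealSubfield L) L)) :
    (∀ t : relNormOneInfUnits (maximalRealSubfield L) L,
      ((χ ((relNormOneInfToIdeles (maximalRealSubfield L) L t : relNormOneIdeles (maximalRealSubfield L) L) :
        relNormOneIdeles (maximalRealSubfield L) L ⧸ relNormOneRat (maximalRealSubfield L) L) : Circle) : ℂ) * P.w t = 1) ↔
    HasArchType L χ (-m) := by
  rw [hasArchType_iff]
  refine forall_congr' fun t => ?_
  rw [hw, archWeight_neg, NumberField.relNormOneInfToQuot_apply]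
  have h0 : archWeight L m t ≠ 0 := fun h0 => by simpa [h0] using norm_archWeight L m t
  exact mul_eq_one_iff_eq_inv₀ h0

/-- The same with the read-off type: for typed `P.w`, the (W-resT) characters are those of type `-P.archType`. -/
theorem residualType_iff_hasArchType_neg_archType (h : ∃ m : InfinitePlace L → ℤ, ⇑(archWeight L m) = P.w)
    (χ : PontryaginDual (relNormOneIdeles (maximalRealSubfield L) L ⧸ relNormOneRat (maximalRealSubfield L) L)) :
    (∀ t : relNormOneInfUnits (maximalRealSubfield L) L,
      ((χ ((relNormOneInfToIdeles (maximalRealSubfield L) L t : relNormOneIdeles (maximalRealSubfield L) L) :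
        relNormOneIdeles (maximalRealSubfield L) L ⧸ relNormOneRat (maximalRealSubfield L) L) : Circle) : ℂ) * P.w t = 1) ↔
    HasArchType L χ (-P.archType) :=
  P.residualType_iff_hasArchType_neg (archWeight_archTypeOf h).symm χ

end WeilPairData
end SupplyResidual

/-! ## 4. N1 for E's binders `S` and `μ` -/

section N1

variable
  (S : ∀ {L : CMField} {ι₁ : L →+* ℂ} (V : HermSpace3 L ι₁) (c : SeesawCtx L), ThetaAdelicSide V c)
  (μ : ∀ {L : CMField}, SeesawCtx L → Fin 4 → InfinitePlace L → ℤ)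

/-- **N1 ⇒ `μ` is READ OFF `S`.**  Under the literal check N1 in binder shape —
`hN1 : ∀ V c k, ((S V c).P k).w = archWeight L (μ c k)`, "`archWeight L (μ c k)` is the character by which
`U(W_k)(L⁺ ⊗ ℝ)` acts on the test vectors of line `k`" — the exponent binder is the read-off type of the adelic
side: `μ c k = ((S V c).P k).archType` (in particular the right-hand side does not depend on `V`). -/
theorem mu_eq_archType
    (hN1 : ∀ {L : CMField} {ι₁ : L →+* ℂ} (V : HermSpace3 L ι₁) (c : SeesawCtx L) (k : Fin 4),
      ((S V c).P k).w = ⇑(archWeight L (μ c k)))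
    {L : CMField} {ι₁ : L →+* ℂ} (V : HermSpace3 L ι₁) (c : SeesawCtx L) (k : Fin 4) :
    μ c k = ((S V c).P k).archType :=
  (((S V c).P k).archType_eq_of_w_eq (hN1 V c k)).symm

/-- N1 in ORBIT form at one level `N ≥ 1` already gives the binder form. -/
theorem w_eq_archWeight_of_N1_orbit {N : ℕ} (hN : N ≠ 0)
    (hN1 : ∀ {L : CMField} {ι₁ : L →+* ℂ} (V : HermSpace3 L ι₁) (c : SeesawCtx L) (k : Fin 4)
      (t : unitaryLineArchTorus L),
      ((S V c).P k).ω (1, relNormOneInfToIdeles (maximalRealSubfield L) L t)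
          (testFun (maximalRealSubfield L) (Fin 3) ((S V c).P k).Φinf ((S V c).P k).x₀ N) =
        archWeight L (μ c k) t • testFun (maximalRealSubfield L) (Fin 3) ((S V c).P k).Φinf ((S V c).P k).x₀ N)
    {L : CMField} {ι₁ : L →+* ℂ} (V : HermSpace3 L ι₁) (c : SeesawCtx L) (k : Fin 4) :
    ((S V c).P k).w = ⇑(archWeight L (μ c k)) :=
  ((S V c).P k).w_eq_archWeight_of_omega hN (hN1 V c k)

variable {L : CMField} {ι₁ : L →+* ℂ} (V : HermSpace3 L ι₁) (c : SeesawCtx L)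

/-- **N1 ⇒ the (12)-side of record is the READ-OFF side**: `d12Of μ c = (-(type of line 0), -(type of line 1))`,
every character of that type allowed. -/
theorem d12Of_eq_of_N1
    (hN1 : ∀ {L : CMField} {ι₁ : L →+* ℂ} (V : HermSpace3 L ι₁) (c : SeesawCtx L) (k : Fin 4),
      ((S V c).P k).w = ⇑(archWeight L (μ c k))) :
    d12Of μ c = (⟨-((S V c).P 0).archType, -((S V c).P 1).archType⟩ : SideArchType L).side := by
  rw [d12Of, mu_eq_archType S μ hN1 V c 0, mu_eq_archType S μ hN1 V c 1]

/-- **N1 ⇒ the (34)-side of record is the READ-OFF side.** -/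
theorem d34Of_eq_of_N1
    (hN1 : ∀ {L : CMField} {ι₁ : L →+* ℂ} (V : HermSpace3 L ι₁) (c : SeesawCtx L) (k : Fin 4),
      ((S V c).P k).w = ⇑(archWeight L (μ c k))) :
    d34Of μ c = (⟨-((S V c).P 2).archType, -((S V c).P 3).archType⟩ : SideArchType L).side := by
  rw [d34Of, mu_eq_archType S μ hN1 V c 2, mu_eq_archType S μ hN1 V c 3]

/-- **N1 ⇒ the supply of line `k` produces characters of the side type.**  The (W-resT) type condition for line
`k` of `S V c` is `HasArchType L χ (-μ c k)`; with `d12Of_m₁ : (d12Of μ c).m₁ = -μ c 0`, `d12Of_m₂`, `d34Of_m₁`,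
`d34Of_m₂` (`ThetaSideInstance`, `rfl`) these are the component types of `SeesawTorus.allowedChars` of the
(12)/(34) torus data (`charPair_mem_allowedChars_iff`). -/
theorem residualType_iff_of_N1
    (hN1 : ∀ {L : CMField} {ι₁ : L →+* ℂ} (V : HermSpace3 L ι₁) (c : SeesawCtx L) (k : Fin 4),
      ((S V c).P k).w = ⇑(archWeight L (μ c k)))
    (k : Fin 4)
    (χ : PontryaginDual (relNormOneIdeles (maximalRealSubfield L) L ⧸ relNormOneRat (maximalRealSubfield L) L)) :
    (∀ t : relNormOneInfUnits (maximalRealSubfield L) L,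
      ((χ ((relNormOneInfToIdeles (maximalRealSubfield L) L t : relNormOneIdeles (maximalRealSubfield L) L) :
        relNormOneIdeles (maximalRealSubfield L) L ⧸ relNormOneRat (maximalRealSubfield L) L) : Circle) : ℂ) *
        ((S V c).P k).w t = 1) ↔
    HasArchType (L : Type) χ (-μ c k) :=
  ((S V c).P k).residualType_iff_hasArchType_neg (hN1 V c k) χ

/-- The pairs of (W-resT) characters of lines `0, 1` are exactly the characters of the (12)-side's index set. -/
theorem charPair_mem_allowedChars_d12_iff_of_N1
    (hN1 : ∀ {L : CMField} {ι₁ : L →+* ℂ} (V : HermSpace3 L ι₁) (c : SeesawCtx L) (k : Fin 4),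
      ((S V c).P k).w = ⇑(archWeight L (μ c k)))
    (χ₀ χ₁ : PontryaginDual (relNormOneIdeles (maximalRealSubfield L) L ⧸ relNormOneRat (maximalRealSubfield L) L)) :
    NumberField.SeesawTorus.charPair χ₀ χ₁ ∈
        NumberField.SeesawTorus.allowedChars (L : Type) (d12Of μ c).m₁ (d12Of μ c).m₂ ↔
      (∀ t : relNormOneInfUnits (maximalRealSubfield L) L,
        ((χ₀ ((relNormOneInfToIdeles (maximalRealSubfield L) L t : relNormOneIdeles (maximalRealSubfield L) L) :
          relNormOneIdeles (maximalRealSubfield L) L ⧸ relNormOneRat (maximalRealSubfield L) L) : Circle) : ℂ) *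
          ((S V c).P 0).w t = 1) ∧
      (∀ t : relNormOneInfUnits (maximalRealSubfield L) L,
        ((χ₁ ((relNormOneInfToIdeles (maximalRealSubfield L) L t : relNormOneIdeles (maximalRealSubfield L) L) :
          relNormOneIdeles (maximalRealSubfield L) L ⧸ relNormOneRat (maximalRealSubfield L) L) : Circle) : ℂ) *
          ((S V c).P 1).w t = 1) := by
  rw [NumberField.SeesawTorus.charPair_mem_allowedChars_iff, d12Of_m₁, d12Of_m₂,
    residualType_iff_of_N1 S μ V c hN1 0 χ₀, residualType_iff_of_N1 S μ V c hN1 1 χ₁]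

/-- The pairs of (W-resT) characters of lines `2, 3` are exactly the characters of the (34)-side's index set. -/
theorem charPair_mem_allowedChars_d34_iff_of_N1
    (hN1 : ∀ {L : CMField} {ι₁ : L →+* ℂ} (V : HermSpace3 L ι₁) (c : SeesawCtx L) (k : Fin 4),
      ((S V c).P k).w = ⇑(archWeight L (μ c k)))
    (χ₂ χ₃ : PontryaginDual (relNormOneIdeles (maximalRealSubfield L) L ⧸ relNormOneRat (maximalRealSubfield L) L)) :
    NumberField.SeesawTorus.charPair χ₂ χ₃ ∈
        NumberField.SeesawTorus.allowedChars (L : Type) (d34Of μ c).m₁ (d34Of μ c).m₂ ↔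
      (∀ t : relNormOneInfUnits (maximalRealSubfield L) L,
        ((χ₂ ((relNormOneInfToIdeles (maximalRealSubfield L) L t : relNormOneIdeles (maximalRealSubfield L) L) :
          relNormOneIdeles (maximalRealSubfield L) L ⧸ relNormOneRat (maximalRealSubfield L) L) : Circle) : ℂ) *
          ((S V c).P 2).w t = 1) ∧
      (∀ t : relNormOneInfUnits (maximalRealSubfield L) L,
        ((χ₃ ((relNormOneInfToIdeles (maximalRealSubfield L) L t : relNormOneIdeles (maximalRealSubfield L) L) :
          relNormOneIdeles (maximalRealSubfield L) L ⧸ relNormOneRat (maximalRealSubfield L) L) : Circle) : ℂ) *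
          ((S V c).P 3).w t = 1) := by
  rw [NumberField.SeesawTorus.charPair_mem_allowedChars_iff, d34Of_m₁, d34Of_m₂,
    residualType_iff_of_N1 S μ V c hN1 2 χ₂, residualType_iff_of_N1 S μ V c hN1 3 χ₃]

end N1

end Model
end HodgeCM

end
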